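import Mathlib.RingTheory.Ideal.KrullsHeightTheorem
import Mathlib.RingTheory.Nullstellensatz
import Mathlib.RingTheory.Jacobson.Ring
import Mathlib.Data.Matrix.Mul
import HarnessLib

/-!
# Common isotropic pairs of `2n − 2` bilinear forms (Bläser 2003, Lemma 6)

Topic `Literature/Computability/AlgebraicComplexity`. Third proof file behind
`SmallFormatRank.lean` (target `blaser2003_thm14`, Bläser 2003, Thm. 14). It proves the one
ingredient of Bläser's argument that is not linear algebra:

* `exists_isotropic_pair` — over an algebraically closed field `k`, any `r ≤ 2n − 2` matrices
  `A_1, …, A_r ∈ k^{n×n}` (`n ≥ 1`) admit non-zero vectors `u, v ∈ k^n` with `uᵀ A_i v = 0` for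
  all `i`. This is **Bläser 2003, Lemma 6** ("there are invertible matrices `u, v` such that
  `u a_1 v, …, u a_{2n−2} v ∈ Z_1^{n,n}`", i.e. all `(u a_i v)_{11} = 0`; proved in Bläser,
  *Lower bounds for the multiplicative complexity of matrix multiplication*, Comput. Complexity 8
  (1999), §4) in vector form: the first row of `u` and the first column of `v` are the pair.

## Proof (dimension count, via Krull's height theorem)

The statement says that `2n − 2` hypersurfaces of bidegree `(1,1)` in `ℙ^{n−1} × ℙ^{n−1}`
intersect. We run the affine-cone version of the standard argument with the tools Mathlib has.
Let `T = k[z_{ij}]`, `φ : T → k[x_i, y_j]`, `z_{ij} ↦ x_i y_j` (`segreMap`), and for a set `D`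
of the variables `x_i, y_j` let `ψ_D` kill the variables in `D` (`killVars`). The ideals
`P_t = ker(ψ_{D_t} ∘ φ)` (`chainIdeal`) for the increasing sets
`D_0 = ∅ ⊂ {x_1} ⊂ ⋯ ⊂ {x_1..x_{n−1}} ⊂ {x_1..x_{n−1}, y_1} ⊂ ⋯ ⊂ {x_1..x_{n−1}, y_1..y_n} = D_{2n−1}`
are prime (kernels of maps to a domain) and strictly increasing (explicit witnesses `z_{ij}`),
`P_0 ⊇` the `2 × 2` minors and `P_{2n−1} = 𝔪_0` is the ideal of the origin. In
`S = T ⧸ P_0` this is a chain of primes of length `2n − 1` ending at `𝔪_0 / P_0`, so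
`height(𝔪_0/P_0) ≥ 2n − 1`. If there were no isotropic pair, then every prime `Q` with
`P_0 + (ℓ_1, …, ℓ_r) ⊆ Q ⊆ 𝔪_0` (the `ℓ_i = ∑ (A_i)_{ab} z_{ab}` being the linear forms) equals
`𝔪_0`: otherwise, `T` being Jacobson, some maximal ideal `M ≠ 𝔪_0` contains `Q`, and by the
Nullstellensatz `M = 𝔪_x` for a point `x ≠ 0` which is a rank-one matrix `x = u vᵀ` (the minors
vanish) with `uᵀ A_i v = ℓ_i(x) = 0`. Hence `𝔪_0/P_0` is minimal over an ideal generated by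
`r ≤ 2n − 2` elements, and Krull's height theorem
(`Ideal.height_le_card_of_mem_minimalPrimes_span_finset`) gives `height ≤ 2n − 2`,
a contradiction.

## References

* M. Bläser, *On the complexity of the multiplication of matrices of small formats*,
  J. Complexity 19 (2003) 43–60, Lemma 6 (p. 50). [Blaser2003]
* M. Bläser, *Lower bounds for the multiplicative complexity of matrix multiplication*,
  Comput. Complexity 8 (1999) 203–226, §4 (the original proof).
-/

noncomputable section

namespace Literature.Computability.AlgebraicComplexity

open MvPolynomial Matrix

section Segre

variable (k : Type*) [Field k] (n : ℕ)

/-- The Segre substitution `φ : k[z_{ij}] → k[x_i, y_j]`, `z_{ij} ↦ x_i y_j`.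
[cite: Blaser2003, Lemma 6] -/
def segreMap : MvPolynomial (Fin n × Fin n) k →ₐ[k] MvPolynomial (Fin n ⊕ Fin n) k :=
  aeval fun p => X (Sum.inl p.1) * X (Sum.inr p.2)

/-- The substitution killing the variables in `D` (and fixing the others).
[cite: Blaser2003, Lemma 6] -/
def killVars (D : Finset (Fin n ⊕ Fin n)) :
    MvPolynomial (Fin n ⊕ Fin n) k →ₐ[k] MvPolynomial (Fin n ⊕ Fin n) k :=
  aeval fun v => if v ∈ D then 0 else X v

/-- The increasing sets of variables `D_t`: `x_i` for `i < min(t, n−1)` and `y_j` for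
`j + (n − 1) < t`; so `D_0 = ∅`, `D_{n−1} = {x_1..x_{n−1}}`, `D_{2n−1} ⊇ {y_1..y_n}`.
[cite: Blaser2003, Lemma 6] -/
def chainVars (t : ℕ) : Finset (Fin n ⊕ Fin n) :=
  ((Finset.univ.filter fun i : Fin n => (i : ℕ) < min t (n - 1)).map
      ⟨Sum.inl, Sum.inl_injective⟩) ∪
    ((Finset.univ.filter fun j : Fin n => (j : ℕ) + (n - 1) < t).map
      ⟨Sum.inr, Sum.inr_injective⟩)

/-- The prime ideals `P_t = ker(ψ_{D_t} ∘ φ) ⊆ k[z_{ij}]`. [cite: Blaser2003, Lemma 6] -/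
def chainIdeal (t : ℕ) : Ideal (MvPolynomial (Fin n × Fin n) k) :=
  RingHom.ker (((killVars k n (chainVars n t)).comp (segreMap k n)).toRingHom)

variable {k n}

/-- Membership in `D_t` of an `x`-variable. [cite: Blaser2003, Lemma 6] -/
@[simp] theorem inl_mem_chainVars {t : ℕ} {i : Fin n} :
    Sum.inl i ∈ chainVars n t ↔ (i : ℕ) < min t (n - 1) := by
  simp [chainVars]

/-- Membership in `D_t` of a `y`-variable. [cite: Blaser2003, Lemma 6] -/
@[simp] theorem inr_mem_chainVars {t : ℕ} {j : Fin n} :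
    Sum.inr j ∈ chainVars n t ↔ (j : ℕ) + (n - 1) < t := by
  simp [chainVars]

/-- The `D_t` increase. [cite: Blaser2003, Lemma 6] -/
theorem chainVars_mono {t t' : ℕ} (h : t ≤ t') : chainVars n t ⊆ chainVars n t' := by
  intro v hv
  rcases v with i | j
  · rw [inl_mem_chainVars] at hv ⊢
    exact lt_of_lt_of_le hv (min_le_min_right _ h)
  · rw [inr_mem_chainVars] at hv ⊢
    omega

/-- Membership in `P_t`. [cite: Blaser2003, Lemma 6] -/
theorem mem_chainIdeal {t : ℕ} {f : MvPolynomial (Fin n × Fin n) k} :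
    f ∈ chainIdeal k n t ↔ killVars k n (chainVars n t) (segreMap k n f) = 0 := by
  simp [chainIdeal, RingHom.mem_ker]

/-- Killing more variables after killing fewer is killing more. [cite: Blaser2003, Lemma 6] -/
theorem killVars_comp_killVars {D D' : Finset (Fin n ⊕ Fin n)} (h : D ⊆ D') :
    (killVars k n D').comp (killVars k n D) = killVars k n D' := by
  refine MvPolynomial.algHom_ext fun v => ?_
  by_cases hv : v ∈ D
  · simp [killVars, hv, h hv]
  · simp [killVars, hv]

/-- The `P_t` are prime: kernels of ring maps into a domain. [cite: Blaser2003, Lemma 6] -/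
instance chainIdeal_isPrime (t : ℕ) : (chainIdeal k n t).IsPrime := by
  unfold chainIdeal
  exact RingHom.ker_isPrime _

/-- The `P_t` increase. [cite: Blaser2003, Lemma 6] -/
theorem chainIdeal_mono {t t' : ℕ} (h : t ≤ t') : chainIdeal k n t ≤ chainIdeal k n t' := by
  intro f hf
  rw [mem_chainIdeal] at hf ⊢
  have := congrArg (killVars k n (chainVars n t')) hf
  rwa [map_zero, ← AlgHom.comp_apply, killVars_comp_killVars (chainVars_mono h)] at this

/-- The image of a variable `z_{ij}` under `ψ_D ∘ φ`. [cite: Blaser2003, Lemma 6] -/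
theorem killVars_segreMap_X (D : Finset (Fin n ⊕ Fin n)) (p : Fin n × Fin n) :
    killVars k n D (segreMap k n (X p)) =
      (if Sum.inl p.1 ∈ D then 0 else X (Sum.inl p.1)) *
        (if Sum.inr p.2 ∈ D then 0 else X (Sum.inr p.2)) := by
  simp [segreMap, killVars]

/-- The `P_t` increase strictly up to `t = 2n − 1`: the variable `z_{t,n}` (`t < n − 1`), resp.
`z_{n, t−n+2}` (`n − 1 ≤ t < 2n − 1`), lies in `P_{t+1} ∖ P_t`. [cite: Blaser2003, Lemma 6] -/
theorem chainIdeal_lt (hn : 1 ≤ n) {t : ℕ} (ht : t + 1 ≤ 2 * n - 1) :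
    chainIdeal k n t < chainIdeal k n (t + 1) := by
  refine lt_of_le_of_ne (chainIdeal_mono (Nat.le_succ t)) fun heq => ?_
  have hlast : n - 1 < n := by omega
  -- the witness
  obtain ⟨p, hp_in, hp_out⟩ : ∃ p : Fin n × Fin n,
      X p ∈ chainIdeal k n (t + 1) ∧ X p ∉ chainIdeal k n t := by
    by_cases htn : t < n - 1
    · refine ⟨(⟨t, by omega⟩, ⟨n - 1, hlast⟩), ?_, ?_⟩
      · rw [mem_chainIdeal, killVars_segreMap_X]
        simp [show t < min (t + 1) (n - 1) by omega]
      · rw [mem_chainIdeal, killVars_segreMap_X]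
        have h1 : ¬ (t < min t (n - 1)) := by omega
        have h2 : ¬ (n - 1 + (n - 1) < t) := by omega
        simp only [inl_mem_chainVars, inr_mem_chainVars, h1, h2, if_false]
        exact mul_ne_zero (X_ne_zero _) (X_ne_zero _)
    · refine ⟨(⟨n - 1, hlast⟩, ⟨t - (n - 1), by omega⟩), ?_, ?_⟩
      · rw [mem_chainIdeal, killVars_segreMap_X]
        simp [show t - (n - 1) + (n - 1) < t + 1 by omega]
      · rw [mem_chainIdeal, killVars_segreMap_X]
        have h1 : ¬ (n - 1 < min t (n - 1)) := by omega
        have h2 : ¬ (t - (n - 1) + (n - 1) < t) := by omega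
        simp only [inl_mem_chainVars, inr_mem_chainVars, h1, h2, if_false]
        exact mul_ne_zero (X_ne_zero _) (X_ne_zero _)
  rw [heq] at hp_out
  exact hp_out hp_in

/-- The `2 × 2` minors `z_{ab} z_{a'b'} − z_{ab'} z_{a'b}` lie in `P_0 = ker φ` (indeed in every
`P_t`). [cite: Blaser2003, Lemma 6] -/
theorem minor_mem_chainIdeal (t : ℕ) (a a' b b' : Fin n) :
    X (a, b) * X (a', b') - X (a, b') * X (a', b) ∈ chainIdeal k n t := by
  rw [mem_chainIdeal, map_sub, map_mul, map_mul, map_sub, map_mul, map_mul]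
  simp only [killVars_segreMap_X]
  ring

/-- `ψ_{D_{2n−1}} ∘ φ` kills every variable, so it factors through evaluation at the origin:
every polynomial vanishing at `0` lies in `P_{2n−1}`. [cite: Blaser2003, Lemma 6] -/
theorem vanishingIdeal_zero_le_chainIdeal (hn : 1 ≤ n) :
    (vanishingIdeal k ({0} : Set (Fin n × Fin n → k))) ≤ chainIdeal k n (2 * n - 1) := by
  intro f hf
  rw [mem_vanishingIdeal_singleton_iff] at hf
  rw [mem_chainIdeal, ← AlgHom.comp_apply]
  have hcomp : (killVars k n (chainVars n (2 * n - 1))).comp (segreMap k n) =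
      (Algebra.ofId k (MvPolynomial (Fin n ⊕ Fin n) k)).comp
        (aeval (0 : Fin n × Fin n → k)) := by
    refine MvPolynomial.algHom_ext fun p => ?_
    rw [AlgHom.comp_apply, killVars_segreMap_X]
    have h2 : (p.2 : ℕ) + (n - 1) < 2 * n - 1 := by omega
    simp [h2]
  rw [hcomp, AlgHom.comp_apply, hf, map_zero]

/-- The linear form `ℓ_A = ∑_{a,b} A_{ab} z_{ab}` of a matrix `A`. [cite: Blaser2003, Lemma 6] -/
def linForm (A : Matrix (Fin n) (Fin n) k) : MvPolynomial (Fin n × Fin n) k :=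
  ∑ p : Fin n × Fin n, C (A p.1 p.2) * X p

/-- `ℓ_A(x) = ∑ A_{ab} x_{ab}`. [cite: Blaser2003, Lemma 6] -/
theorem aeval_linForm (A : Matrix (Fin n) (Fin n) k) (x : Fin n × Fin n → k) :
    aeval x (linForm A) = ∑ p : Fin n × Fin n, A p.1 p.2 * x p := by
  simp [linForm, map_sum]

/-- `ℓ_A` vanishes at the origin. [cite: Blaser2003, Lemma 6] -/
theorem linForm_mem_vanishingIdeal_zero (A : Matrix (Fin n) (Fin n) k) :
    linForm A ∈ (vanishingIdeal k ({0} : Set (Fin n × Fin n → k))) := by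
  rw [mem_vanishingIdeal_singleton_iff, aeval_linForm]
  simp

end Segre

/-- **Bläser 2003, Lemma 6** (vector form; Bläser 1999b, §4). Over an algebraically closed field
`k`, any `r ≤ 2n − 2` square matrices `A_i ∈ k^{n×n}` (`n ≥ 1`) have a common isotropic pair:
non-zero `u, v ∈ k^n` with `uᵀ A_i v = 0` for all `i`. (Printed form: there are invertible
`u, v` with all `u a_i v ∈ Z_1^{n,n}`, i.e. `(u a_i v)_{11} = 0`; take `uᵀ` as the first row of
`u` and `v` as the first column of `v`.) [cite: Blaser2003, Lemma 6] -/
theorem exists_isotropic_pair (k : Type*) [Field k] [IsAlgClosed k] {n : ℕ} (hn : 1 ≤ n)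
    {ι : Type*} [Fintype ι] (A : ι → Matrix (Fin n) (Fin n) k)
    (hι : Fintype.card ι ≤ 2 * n - 2) :
    ∃ u v : Fin n → k, u ≠ 0 ∧ v ≠ 0 ∧ ∀ i, u ⬝ᵥ (A i *ᵥ v) = 0 := by
  classical
  -- `P₀ = chainIdeal k n 0`, `Ptop = chainIdeal k n (2n-1)`.
  -- Either some prime between `P₀ + (ℓ_i)` and `Ptop` is not `Ptop` (then we find the pair),
  -- or `Ptop / P₀` is minimal over `(ℓ_i)` in `T ⧸ P₀` (contradicting Krull's height theorem).
  by_cases hmin : ∀ Q : Ideal (MvPolynomial (Fin n × Fin n) k), Q.IsPrime →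
      chainIdeal k n 0 ≤ Q → (∀ i, linForm (A i) ∈ Q) → Q ≤ chainIdeal k n (2 * n - 1) →
      Q = chainIdeal k n (2 * n - 1)
  · exfalso
    -- the quotient `S = T ⧸ P₀` and the chain of primes `p_t = P_t / P₀`
    have hmk_surj : Function.Surjective (Ideal.Quotient.mk (chainIdeal k n 0)) :=
      Ideal.Quotient.mk_surjective
    let p : ℕ → Ideal (MvPolynomial (Fin n × Fin n) k ⧸ chainIdeal k n 0) := fun t =>
      (chainIdeal k n t).map (Ideal.Quotient.mk (chainIdeal k n 0))
    have hp_prime : ∀ t, (p t).IsPrime := fun t =>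
      Ideal.isPrime_map_quotientMk_of_isPrime (chainIdeal_mono (Nat.zero_le t))
    have hp_lt : ∀ t, t + 1 ≤ 2 * n - 1 → p t < p (t + 1) := by
      intro t ht
      refine lt_of_le_of_ne (Ideal.map_mono (chainIdeal_mono (Nat.le_succ t))) fun heq => ?_
      have h1 := congrArg (Ideal.comap (Ideal.Quotient.mk (chainIdeal k n 0))) heq
      rw [Ideal.comap_map_mk (chainIdeal_mono (Nat.zero_le t)),
        Ideal.comap_map_mk (chainIdeal_mono (Nat.zero_le (t + 1)))] at h1
      exact (chainIdeal_lt hn ht).ne h1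
    have hp_height : ∀ t, t ≤ 2 * n - 1 → (t : ℕ∞) ≤ (p t).height := by
      intro t
      induction t with
      | zero => intro _; simp
      | succ t ih =>
        intro ht
        haveI := hp_prime t
        haveI := hp_prime (t + 1)
        have h1 := Ideal.height_add_one_le_of_lt_of_isPrime (hp_lt t ht)
        have h2 := ih (by omega)
        calc ((t + 1 : ℕ) : ℕ∞) = (t : ℕ∞) + 1 := by push_cast; ring
          _ ≤ (p t).height + 1 := add_le_add h2 le_rfl
          _ ≤ (p (t + 1)).height := h1
    -- `p_{2n-1}` is minimal over the images of the linear forms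
    set s : Finset (MvPolynomial (Fin n × Fin n) k ⧸ chainIdeal k n 0) :=
      Finset.univ.image fun i => Ideal.Quotient.mk (chainIdeal k n 0) (linForm (A i)) with hs
    have hs_card : s.card ≤ 2 * n - 2 := Finset.card_image_le.trans (by simpa using hι)
    have hlin_top : ∀ i, linForm (A i) ∈ chainIdeal k n (2 * n - 1) := fun i =>
      vanishingIdeal_zero_le_chainIdeal hn (linForm_mem_vanishingIdeal_zero (A i))
    have hminimal : p (2 * n - 1) ∈
        (Ideal.span (s : Set (MvPolynomial (Fin n × Fin n) k ⧸ chainIdeal k n 0))).minimalPrimes := by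
      refine ⟨⟨hp_prime _, ?_⟩, ?_⟩
      · rw [Ideal.span_le]
        intro y hy
        obtain ⟨i, -, rfl⟩ := Finset.mem_image.1 (Finset.mem_coe.1 hy)
        exact Ideal.mem_map_of_mem _ (hlin_top i)
      · rintro q ⟨hq, hsq⟩ hqp
        -- pull back to `T`
        have hQprime : (q.comap (Ideal.Quotient.mk (chainIdeal k n 0))).IsPrime :=
          Ideal.comap_isPrime _ q
        have hP₀Q : chainIdeal k n 0 ≤ q.comap (Ideal.Quotient.mk (chainIdeal k n 0)) := by
          intro f hf
          rw [Ideal.mem_comap, Ideal.Quotient.eq_zero_iff_mem.2 hf]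
          exact q.zero_mem
        have hlinQ : ∀ i, linForm (A i) ∈ q.comap (Ideal.Quotient.mk (chainIdeal k n 0)) := by
          intro i
          rw [Ideal.mem_comap]
          exact hsq (Ideal.subset_span (Finset.mem_image_of_mem _ (Finset.mem_univ i)))
        have hQtop : q.comap (Ideal.Quotient.mk (chainIdeal k n 0)) ≤ chainIdeal k n (2 * n - 1) := by
          have := Ideal.comap_mono (f := Ideal.Quotient.mk (chainIdeal k n 0)) hqp
          rwa [Ideal.comap_map_mk (chainIdeal_mono (Nat.zero_le _))] at this
        have hQeq := hmin _ hQprime hP₀Q hlinQ hQtop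
        -- hence `q = p_{2n-1}`
        have : q = p (2 * n - 1) := by
          rw [← Ideal.map_comap_of_surjective _ hmk_surj q]
          change Ideal.map _ (q.comap (Ideal.Quotient.mk (chainIdeal k n 0))) = _
          rw [hQeq]
        exact this.symm.le
    have hle := Ideal.height_le_card_of_mem_minimalPrimes_span_finset hminimal
    have hge := hp_height (2 * n - 1) le_rfl
    have : ((2 * n - 1 : ℕ) : ℕ∞) ≤ ((s.card : ℕ) : ℕ∞) := hge.trans hle
    have : 2 * n - 1 ≤ s.card := by exact_mod_cast this
    omega
  · -- a prime `Q ≠ Ptop` with `P₀ + (ℓ_i) ⊆ Q ⊆ Ptop`: a maximal ideal `M ≠ Ptop` above it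
    push Not at hmin
    obtain ⟨Q, hQprime, hP₀Q, hlinQ, hQtop, hQne⟩ := hmin
    have hJ : Q.jacobson = Q := IsJacobsonRing.out inferInstance hQprime.isRadical
    obtain ⟨M, hMmax, hQM, hMne⟩ : ∃ M : Ideal (MvPolynomial (Fin n × Fin n) k),
        M.IsMaximal ∧ Q ≤ M ∧ M ≠ chainIdeal k n (2 * n - 1) := by
      by_contra hall
      push Not at hall
      apply hQne (le_antisymm hQtop ?_)
      calc chainIdeal k n (2 * n - 1) ≤ Q.jacobson :=
            le_sInf fun J ⟨hQJ, hJmax⟩ => (hall J hJmax hQJ).symm.le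
        _ = Q := hJ
    -- Nullstellensatz: `M` is the ideal of a point `x ≠ 0`
    obtain ⟨x, rfl⟩ := (MvPolynomial.isMaximal_iff_eq_vanishingIdeal_singleton (K := k)).1 hMmax
    have hx0 : x ≠ 0 := by
      rintro rfl
      exact hMne (hMmax.eq_of_le (Ideal.IsPrime.ne_top inferInstance)
        (vanishingIdeal_zero_le_chainIdeal hn))
    have hvan : ∀ f ∈ Q, aeval x f = 0 := fun f hf =>
      (mem_vanishingIdeal_singleton_iff x f).1 (hQM hf)
    -- the minors vanish at `x`: `x` has rank one
    have hminor : ∀ a a' b b', x (a, b) * x (a', b') = x (a, b') * x (a', b) := by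
      intro a a' b b'
      have := hvan _ (hP₀Q (minor_mem_chainIdeal 0 a a' b b'))
      simp only [map_sub, map_mul, aeval_X] at this
      exact sub_eq_zero.1 this
    -- the linear forms vanish at `x`
    have hlin : ∀ i, ∑ p : Fin n × Fin n, A i p.1 p.2 * x p = 0 := fun i => by
      rw [← aeval_linForm]; exact hvan _ (hlinQ i)
    obtain ⟨⟨a₀, b₀⟩, hx⟩ : ∃ p, x p ≠ 0 := by
      by_contra hall
      push Not at hall
      exact hx0 (funext hall)
    refine ⟨fun a => x (a, b₀), fun b => x (a₀, b) / x (a₀, b₀), ?_, ?_, fun i => ?_⟩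
    · intro h
      exact hx (by simpa using congrFun h a₀)
    · intro h
      have := congrFun h b₀
      simp [div_self hx] at this
    · -- `uᵀ A v = ∑ A_{ab} u_a v_b = ∑ A_{ab} x_{ab} = 0`
      have hfac : ∀ a b, x (a, b₀) * (x (a₀, b) / x (a₀, b₀)) = x (a, b) := by
        intro a b
        rw [mul_div_assoc', div_eq_iff hx, hminor a a₀ b₀ b, mul_comm]
      calc (fun a => x (a, b₀)) ⬝ᵥ (A i *ᵥ fun b => x (a₀, b) / x (a₀, b₀))
          = ∑ a, ∑ b, A i a b * x (a, b) := by
            simp only [dotProduct, Matrix.mulVec, Finset.mul_sum]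
            refine Finset.sum_congr rfl fun a _ => Finset.sum_congr rfl fun b _ => ?_
            rw [← hfac a b]; ring
        _ = ∑ p : Fin n × Fin n, A i p.1 p.2 * x p := by
            rw [← Finset.sum_product']; rfl
        _ = 0 := hlin i

end Literature.Computability.AlgebraicComplexity

end
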